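import Mathlib
import Literature.MathematicalPhysics.StatisticalMechanics.Crystallization

/-!
# Tilted Lennard-Jones wells (line `prestress-split-korn`, statement block S1)

Crux `stmt-AtomisticToContinuum-13603` (`ReggeStarCoercivity.DefectFreeCrystallizes`),
stub `stub_tiltedWells`.

With `V = lennardJones` (`V r = r⁻¹²/12 - r⁻⁶/6`) and the bond tension per squared length
`ω(s) = V'(s)/(2s) = (s⁻⁷ - s⁻¹³)/(2s)` of a reference bond of length `s`, the tilted-well
remainder `F(r, s) = V r - V s - ω(s) (r² - s²)` vanishes to second order on the diagonal and
factors EXACTLY as `F(r, s) = (r² - s²)² · A(r, s) / (12 r¹² s¹⁴)` with the polynomial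
`A(r, s) = 6r¹⁰ + 5r⁸s² + 4r⁶s⁴ + 3r⁴s⁶ + 2r²s⁸ + s¹⁰ - 6r¹⁰s⁶ - 4r⁸s⁸ - 2r⁶s¹⁰`
(`tw_remainder_eq`). Hence a modulus bound `c (r - s)² ≤ F(r, s)` follows from the
NON-degenerate polynomial inequality `12 c r¹² s¹⁴ ≤ (r + s)² A(r, s)` (`tw_of_key`).

Along a ray `r = v s` the key inequality reads `s¹² Φ ≥ 0` with
`Φ = (v+1)² (A₁(v) - s⁶ A₂(v)) - 12 c v¹² s¹⁴` DECREASING in `s`, so it transfers from larger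
to smaller `s` on the same ray (`tw_key_transfer`). On the two boxes of clauses (a), (b) every
ray exits through the edge `s = s_max` or the edge `r = r_max`, where the key inequality is a
one-variable polynomial inequality whose Bernstein coefficients on the edge interval are all
positive; it is discharged by `linarith` fed with the Bernstein products
`(x - a)^i (b - x)^(n-i) ≥ 0` (`tw_edge_*`).

Clause (c) (cables, `s ≥ 6/5`, `|r - s| ≤ s/10`): with `r = v s`,
`F + (11/2) s⁻⁸ (r - s)² = (v - 1)² ((v+1)² A₁(v) + s⁶ v⁶ W(v)) / (12 v¹² s¹²)` with
`W(v) = 66 v⁶ - (v+1)² (6v⁴ + 4v² + 2) ≥ 0` on `v ∈ [9/10, 11/10]` (`tw_W_nonneg`),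
uniformly in `s`.

No calculus is used. The planner's numerics (minimal ratios 3.009 / 0.9216 / -5.195·s⁻⁸)
are consistent with the margins seen here: edge minima 0.963 = 12·r¹²s¹⁴·(3.009 - 2.95) at
`(21/20, 49/50)` and 4.98 at `(6/5, 1)`.
-/

namespace Summit.AtomisticToContinuum.Crystallization.Theorems.PrestressSplitKorn

open Literature.MathematicalPhysics.StatisticalMechanics

/-- Exact factorisation of the tilted-well remainder minus a quadratic modulus term:
`V r - V s - ω(s)(r² - s²) - c (r - s)²`
`= (r - s)² ((r + s)² A(r, s) - 12 c r¹² s¹⁴) / (12 r¹² s¹⁴)`. -/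
theorem tw_remainder_eq (c r s : ℝ) (hr : r ≠ 0) (hs : s ≠ 0) :
    lennardJones r - lennardJones s - (s⁻¹ ^ 7 - s⁻¹ ^ 13) / (2 * s) * (r ^ 2 - s ^ 2) -
        c * (r - s) ^ 2 =
      (r - s) ^ 2 * ((r + s) ^ 2 *
      (6 * r ^ 10 + 5 * r ^ 8 * s ^ 2 + 4 * r ^ 6 * s ^ 4 + 3 * r ^ 4 * s ^ 6 + 2 * r ^ 2 *
          s ^ 8 + s ^ 10 - 6 * r ^ 10 * s ^ 6 - 4 * r ^ 8 * s ^ 8 - 2 * r ^ 6 * s ^ 10) - 12 * c *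
          r ^ 12 * s ^ 14) /
        (12 * r ^ 12 * s ^ 14) := by
  unfold lennardJones
  field_simp
  ring

/-- The modulus bound `c (r - s)² ≤ V r - V s - ω(s)(r² - s²)` follows from the key polynomial
inequality `12 c r¹² s¹⁴ ≤ (r + s)² A(r, s)` (for `r, s > 0`). -/
theorem tw_of_key {c r s : ℝ} (hr : 0 < r) (hs : 0 < s)
    (hkey : 12 * c * r ^ 12 * s ^ 14 ≤ (r + s) ^ 2 *
      (6 * r ^ 10 + 5 * r ^ 8 * s ^ 2 + 4 * r ^ 6 * s ^ 4 + 3 * r ^ 4 * s ^ 6 + 2 * r ^ 2 *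
          s ^ 8 + s ^ 10 - 6 * r ^ 10 * s ^ 6 - 4 * r ^ 8 * s ^ 8 - 2 * r ^ 6 * s ^ 10)) :
    c * (r - s) ^ 2 ≤
      lennardJones r - lennardJones s - (s⁻¹ ^ 7 - s⁻¹ ^ 13) / (2 * s) * (r ^ 2 - s ^ 2) := by
  have h := tw_remainder_eq c r s hr.ne' hs.ne'
  have h0 : 0 ≤ (r - s) ^ 2 * ((r + s) ^ 2 *
      (6 * r ^ 10 + 5 * r ^ 8 * s ^ 2 + 4 * r ^ 6 * s ^ 4 + 3 * r ^ 4 * s ^ 6 + 2 * r ^ 2 *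
          s ^ 8 + s ^ 10 - 6 * r ^ 10 * s ^ 6 - 4 * r ^ 8 * s ^ 8 - 2 * r ^ 6 * s ^ 10) - 12 * c *
          r ^ 12 * s ^ 14) /
        (12 * r ^ 12 * s ^ 14) := by
    apply div_nonneg
    · exact mul_nonneg (sq_nonneg _) (sub_nonneg.mpr hkey)
    · positivity
  linarith

/-- Transfer of the key inequality along a ray `r / s = r' / s'` from the point with the LARGER
reference length `s' ≥ s` to the one with the smaller: with `r = v s` the defect
`(r + s)² A - 12 c r¹² s¹⁴` equals `s¹² Φ(v, s)` where
`Φ(v, s) = (v + 1)² (A₁ v - s⁶ A₂ v) - 12 c v¹² s¹⁴` is decreasing in `s > 0`. -/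
theorem tw_key_transfer {c r s r' s' : ℝ} (hc : 0 ≤ c) (hr : 0 < r) (hs : 0 < s)
    (hss' : s ≤ s') (hray : r' * s = r * s')
    (H : 12 * c * r' ^ 12 * s' ^ 14 ≤ (r' + s') ^ 2 *
      (6 * r' ^ 10 + 5 * r' ^ 8 * s' ^ 2 + 4 * r' ^ 6 * s' ^ 4 + 3 * r' ^ 4 * s' ^ 6 + 2 *
          r' ^ 2 * s' ^ 8 + s' ^ 10 - 6 * r' ^ 10 * s' ^ 6 - 4 * r' ^ 8 * s' ^ 8 - 2 * r' ^ 6 *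
          s' ^ 10)) :
    12 * c * r ^ 12 * s ^ 14 ≤ (r + s) ^ 2 *
      (6 * r ^ 10 + 5 * r ^ 8 * s ^ 2 + 4 * r ^ 6 * s ^ 4 + 3 * r ^ 4 * s ^ 6 + 2 * r ^ 2 *
          s ^ 8 + s ^ 10 - 6 * r ^ 10 * s ^ 6 - 4 * r ^ 8 * s ^ 8 - 2 * r ^ 6 * s ^ 10) := by
  obtain ⟨v, hv, rfl⟩ : ∃ v, 0 < v ∧ r = v * s :=
    ⟨r / s, div_pos hr hs, (div_mul_cancel₀ r hs.ne').symm⟩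
  have hr' : r' = v * s' := mul_right_cancel₀ hs.ne' (by rw [hray]; ring)
  subst hr'
  have hs' : 0 < s' := lt_of_lt_of_le hs hss'
  have e : ∀ t : ℝ, (v * t + t) ^ 2 *
      (6 * (v * t) ^ 10 + 5 * (v * t) ^ 8 * t ^ 2 + 4 * (v * t) ^ 6 * t ^ 4 + 3 * (v * t) ^ 4 *
          t ^ 6 + 2 * (v * t) ^ 2 * t ^ 8 + t ^ 10 - 6 * (v * t) ^ 10 * t ^ 6 - 4 * (v * t) ^ 8 *
          t ^ 8 - 2 * (v * t) ^ 6 * t ^ 10) - 12 * c * (v * t) ^ 12 * t ^ 14 =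
      t ^ 12 * ((v + 1) ^ 2 * ((6 * v ^ 10 + 5 * v ^ 8 + 4 * v ^ 6 + 3 * v ^ 4 + 2 * v ^ 2 + 1) -
          t ^ 6 * (6 * v ^ 10 + 4 * v ^ 8 + 2 * v ^ 6)) - 12 * c * v ^ 12 * t ^ 14) := by
    intro t
    ring
  have h1 : 0 ≤ ((v + 1) ^ 2 * ((6 * v ^ 10 + 5 * v ^ 8 + 4 * v ^ 6 + 3 * v ^ 4 + 2 * v ^ 2 + 1) -
      s' ^ 6 * (6 * v ^ 10 + 4 * v ^ 8 + 2 * v ^ 6)) - 12 * c * v ^ 12 * s' ^ 14) := by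
    have h0 : 0 ≤ s' ^ 12 * ((v + 1) ^ 2 * ((6 * v ^ 10 + 5 * v ^ 8 + 4 * v ^ 6 + 3 * v ^ 4 + 2 *
        v ^ 2 + 1) - s' ^ 6 * (6 * v ^ 10 + 4 * v ^ 8 + 2 * v ^ 6)) - 12 * c * v ^ 12 *
        s' ^ 14) := by
      rw [← e s']
      linarith
    exact (mul_nonneg_iff_of_pos_left (by positivity)).mp h0
  have h6 : s ^ 6 ≤ s' ^ 6 := pow_le_pow_left₀ hs.le hss' 6
  have h14 : s ^ 14 ≤ s' ^ 14 := pow_le_pow_left₀ hs.le hss' 14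
  have hA2 : 0 ≤ (v + 1) ^ 2 * (6 * v ^ 10 + 4 * v ^ 8 + 2 * v ^ 6) := by positivity
  have hcv : 0 ≤ 12 * c * v ^ 12 := by positivity
  have h2 : ((v + 1) ^ 2 * ((6 * v ^ 10 + 5 * v ^ 8 + 4 * v ^ 6 + 3 * v ^ 4 + 2 * v ^ 2 + 1) -
      s' ^ 6 * (6 * v ^ 10 + 4 * v ^ 8 + 2 * v ^ 6)) - 12 * c * v ^ 12 * s' ^ 14) ≤
      ((v + 1) ^ 2 * ((6 * v ^ 10 + 5 * v ^ 8 + 4 * v ^ 6 + 3 * v ^ 4 + 2 * v ^ 2 + 1) - s ^ 6 *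
          (6 * v ^ 10 + 4 * v ^ 8 + 2 * v ^ 6)) - 12 * c * v ^ 12 * s ^ 14) := by
    nlinarith [mul_le_mul_of_nonneg_left h6 hA2, mul_le_mul_of_nonneg_left h14 hcv]
  have h3 : 0 ≤ s ^ 12 * ((v + 1) ^ 2 * ((6 * v ^ 10 + 5 * v ^ 8 + 4 * v ^ 6 + 3 * v ^ 4 + 2 *
      v ^ 2 + 1) - s ^ 6 * (6 * v ^ 10 + 4 * v ^ 8 + 2 * v ^ 6)) - 12 * c * v ^ 12 * s ^ 14) :=
    mul_nonneg (by positivity) (h1.trans h2)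
  linarith [e s]

/-- Edge `s = 49/50`, `r ∈ [9/10, 21/20]` of clause (a): a degree-12 polynomial inequality in `r`
whose Bernstein coefficients on the interval are all positive (minimum `0.963` at `r = 21/20`). -/
theorem tw_edge_a1 (r : ℝ) (h1 : 9 / 10 ≤ r) (h2 : r ≤ 21 / 20) :
    12 * (59 / 20) * r ^ 12 * (49 / 50) ^ 14 ≤ (r + (49 / 50)) ^ 2 *
      (6 * r ^ 10 + 5 * r ^ 8 * (49 / 50) ^ 2 + 4 * r ^ 6 * (49 / 50) ^ 4 + 3 * r ^ 4 *
          (49 / 50) ^ 6 + 2 * r ^ 2 * (49 / 50) ^ 8 + (49 / 50) ^ 10 - 6 * r ^ 10 *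
          (49 / 50) ^ 6 - 4 * r ^ 8 * (49 / 50) ^ 8 - 2 * r ^ 6 * (49 / 50) ^ 10) := by
  have ha : (0 : ℝ) ≤ r - 9 / 10 := by linarith
  have hb : (0 : ℝ) ≤ 21 / 20 - r := by linarith
  linarith [mul_nonneg (pow_nonneg ha 0) (pow_nonneg hb 12),
    mul_nonneg (pow_nonneg ha 1) (pow_nonneg hb 11),
    mul_nonneg (pow_nonneg ha 2) (pow_nonneg hb 10),
    mul_nonneg (pow_nonneg ha 3) (pow_nonneg hb 9),
    mul_nonneg (pow_nonneg ha 4) (pow_nonneg hb 8),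
    mul_nonneg (pow_nonneg ha 5) (pow_nonneg hb 7),
    mul_nonneg (pow_nonneg ha 6) (pow_nonneg hb 6),
    mul_nonneg (pow_nonneg ha 7) (pow_nonneg hb 5),
    mul_nonneg (pow_nonneg ha 8) (pow_nonneg hb 4),
    mul_nonneg (pow_nonneg ha 9) (pow_nonneg hb 3),
    mul_nonneg (pow_nonneg ha 10) (pow_nonneg hb 2),
    mul_nonneg (pow_nonneg ha 11) (pow_nonneg hb 1),
    mul_nonneg (pow_nonneg ha 12) (pow_nonneg hb 0)]

/-- Edge `r = 21/20`, `s ∈ [24/25, 49/50]` of clause (a): a degree-14 polynomial inequality in `s`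
whose Bernstein coefficients on the interval are all positive (minimum `0.963` at `s = 49/50`). -/
theorem tw_edge_a2 (s : ℝ) (h1 : 24 / 25 ≤ s) (h2 : s ≤ 49 / 50) :
    12 * (59 / 20) * (21 / 20) ^ 12 * s ^ 14 ≤ ((21 / 20) + s) ^ 2 *
      (6 * (21 / 20) ^ 10 + 5 * (21 / 20) ^ 8 * s ^ 2 + 4 * (21 / 20) ^ 6 * s ^ 4 + 3 *
          (21 / 20) ^ 4 * s ^ 6 + 2 * (21 / 20) ^ 2 * s ^ 8 + s ^ 10 - 6 * (21 / 20) ^ 10 *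
          s ^ 6 - 4 * (21 / 20) ^ 8 * s ^ 8 - 2 * (21 / 20) ^ 6 * s ^ 10) := by
  have ha : (0 : ℝ) ≤ s - 24 / 25 := by linarith
  have hb : (0 : ℝ) ≤ 49 / 50 - s := by linarith
  linarith [mul_nonneg (pow_nonneg ha 0) (pow_nonneg hb 14),
    mul_nonneg (pow_nonneg ha 1) (pow_nonneg hb 13),
    mul_nonneg (pow_nonneg ha 2) (pow_nonneg hb 12),
    mul_nonneg (pow_nonneg ha 3) (pow_nonneg hb 11),
    mul_nonneg (pow_nonneg ha 4) (pow_nonneg hb 10),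
    mul_nonneg (pow_nonneg ha 5) (pow_nonneg hb 9),
    mul_nonneg (pow_nonneg ha 6) (pow_nonneg hb 8),
    mul_nonneg (pow_nonneg ha 7) (pow_nonneg hb 7),
    mul_nonneg (pow_nonneg ha 8) (pow_nonneg hb 6),
    mul_nonneg (pow_nonneg ha 9) (pow_nonneg hb 5),
    mul_nonneg (pow_nonneg ha 10) (pow_nonneg hb 4),
    mul_nonneg (pow_nonneg ha 11) (pow_nonneg hb 3),
    mul_nonneg (pow_nonneg ha 12) (pow_nonneg hb 2),
    mul_nonneg (pow_nonneg ha 13) (pow_nonneg hb 1),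
    mul_nonneg (pow_nonneg ha 14) (pow_nonneg hb 0)]

/-- Edge `s = 1`, `r ∈ [4/5, 6/5]` of clause (b): a degree-12 polynomial inequality in `r` whose
Bernstein coefficients on the interval are all positive (minimum `4.98` at `r = 6/5`). -/
theorem tw_edge_b1 (r : ℝ) (h1 : 4 / 5 ≤ r) (h2 : r ≤ 6 / 5) :
    12 * (7 / 8) * r ^ 12 * 1 ^ 14 ≤ (r + 1) ^ 2 *
      (6 * r ^ 10 + 5 * r ^ 8 * 1 ^ 2 + 4 * r ^ 6 * 1 ^ 4 + 3 * r ^ 4 * 1 ^ 6 + 2 * r ^ 2 *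
          1 ^ 8 + 1 ^ 10 - 6 * r ^ 10 * 1 ^ 6 - 4 * r ^ 8 * 1 ^ 8 - 2 * r ^ 6 * 1 ^ 10) := by
  have ha : (0 : ℝ) ≤ r - 4 / 5 := by linarith
  have hb : (0 : ℝ) ≤ 6 / 5 - r := by linarith
  linarith [mul_nonneg (pow_nonneg ha 0) (pow_nonneg hb 12),
    mul_nonneg (pow_nonneg ha 1) (pow_nonneg hb 11),
    mul_nonneg (pow_nonneg ha 2) (pow_nonneg hb 10),
    mul_nonneg (pow_nonneg ha 3) (pow_nonneg hb 9),
    mul_nonneg (pow_nonneg ha 4) (pow_nonneg hb 8),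
    mul_nonneg (pow_nonneg ha 5) (pow_nonneg hb 7),
    mul_nonneg (pow_nonneg ha 6) (pow_nonneg hb 6),
    mul_nonneg (pow_nonneg ha 7) (pow_nonneg hb 5),
    mul_nonneg (pow_nonneg ha 8) (pow_nonneg hb 4),
    mul_nonneg (pow_nonneg ha 9) (pow_nonneg hb 3),
    mul_nonneg (pow_nonneg ha 10) (pow_nonneg hb 2),
    mul_nonneg (pow_nonneg ha 11) (pow_nonneg hb 1),
    mul_nonneg (pow_nonneg ha 12) (pow_nonneg hb 0)]

/-- Edge `r = 6/5`, `s ∈ [19/20, 1]` of clause (b): a degree-14 polynomial inequality in `s` whose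
Bernstein coefficients on the interval are all positive (minimum `4.98` at `s = 1`). -/
theorem tw_edge_b2 (s : ℝ) (h1 : 19 / 20 ≤ s) (h2 : s ≤ 1) :
    12 * (7 / 8) * (6 / 5) ^ 12 * s ^ 14 ≤ ((6 / 5) + s) ^ 2 *
      (6 * (6 / 5) ^ 10 + 5 * (6 / 5) ^ 8 * s ^ 2 + 4 * (6 / 5) ^ 6 * s ^ 4 + 3 * (6 / 5) ^ 4 *
          s ^ 6 + 2 * (6 / 5) ^ 2 * s ^ 8 + s ^ 10 - 6 * (6 / 5) ^ 10 * s ^ 6 - 4 * (6 / 5) ^ 8 *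
          s ^ 8 - 2 * (6 / 5) ^ 6 * s ^ 10) := by
  have ha : (0 : ℝ) ≤ s - 19 / 20 := by linarith
  have hb : (0 : ℝ) ≤ 1 - s := by linarith
  linarith [mul_nonneg (pow_nonneg ha 0) (pow_nonneg hb 14),
    mul_nonneg (pow_nonneg ha 1) (pow_nonneg hb 13),
    mul_nonneg (pow_nonneg ha 2) (pow_nonneg hb 12),
    mul_nonneg (pow_nonneg ha 3) (pow_nonneg hb 11),
    mul_nonneg (pow_nonneg ha 4) (pow_nonneg hb 10),
    mul_nonneg (pow_nonneg ha 5) (pow_nonneg hb 9),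
    mul_nonneg (pow_nonneg ha 6) (pow_nonneg hb 8),
    mul_nonneg (pow_nonneg ha 7) (pow_nonneg hb 7),
    mul_nonneg (pow_nonneg ha 8) (pow_nonneg hb 6),
    mul_nonneg (pow_nonneg ha 9) (pow_nonneg hb 5),
    mul_nonneg (pow_nonneg ha 10) (pow_nonneg hb 4),
    mul_nonneg (pow_nonneg ha 11) (pow_nonneg hb 3),
    mul_nonneg (pow_nonneg ha 12) (pow_nonneg hb 2),
    mul_nonneg (pow_nonneg ha 13) (pow_nonneg hb 1),
    mul_nonneg (pow_nonneg ha 14) (pow_nonneg hb 0)]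

/-- The key inequality on the whole box of clause (a): every ray `r/s = const` through a point
of the box leaves it through the edge `s = 49 / 50` or the edge `r = 21 / 20` at a point with
larger `s`, and the key inequality transfers back along the ray (`tw_key_transfer`). -/
theorem tw_box_a (r s : ℝ) (hs1 : 24 / 25 ≤ s) (hs2 : s ≤ 49 / 50) (hr1 : 9 / 10 ≤ r)
    (hr2 : r ≤ 21 / 20) :
    12 * (59 / 20) * r ^ 12 * s ^ 14 ≤ (r + s) ^ 2 *
      (6 * r ^ 10 + 5 * r ^ 8 * s ^ 2 + 4 * r ^ 6 * s ^ 4 + 3 * r ^ 4 * s ^ 6 + 2 * r ^ 2 *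
          s ^ 8 + s ^ 10 - 6 * r ^ 10 * s ^ 6 - 4 * r ^ 8 * s ^ 8 - 2 * r ^ 6 * s ^ 10) := by
  have hr : (0 : ℝ) < r := by linarith
  have hs : (0 : ℝ) < s := by linarith
  by_cases hcase : r * (49 / 50) ≤ (21 / 20) * s
  · -- exit through the edge `s = 49 / 50` at `r' = r * (49 / 50) / s`
    have hr'1 : 9 / 10 ≤ r * (49 / 50) / s := by
      rw [le_div_iff₀ hs]
      nlinarith
    have hr'2 : r * (49 / 50) / s ≤ 21 / 20 := by
      rw [div_le_iff₀ hs]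
      linarith
    exact tw_key_transfer (r' := r * (49 / 50) / s) (s' := 49 / 50) (by norm_num) hr hs hs2
      (by field_simp) (tw_edge_a1 _ hr'1 hr'2)
  · -- exit through the edge `r = 21 / 20` at `s' = (21 / 20) * s / r`
    have hcase := not_le.mp hcase
    have hs'1 : 24 / 25 ≤ (21 / 20) * s / r := by
      rw [le_div_iff₀ hr]
      nlinarith
    have hs'2 : (21 / 20) * s / r ≤ 49 / 50 := by
      rw [div_le_iff₀ hr]
      linarith
    have hss' : s ≤ (21 / 20) * s / r := by
      rw [le_div_iff₀ hr]
      nlinarith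
    exact tw_key_transfer (r' := 21 / 20) (s' := (21 / 20) * s / r) (by norm_num) hr hs hss'
      (by field_simp) (tw_edge_a2 _ hs'1 hs'2)

/-- The key inequality on the whole box of clause (b): every ray `r/s = const` through a point
of the box leaves it through the edge `s = 1` or the edge `r = 6 / 5` at a point with
larger `s`, and the key inequality transfers back along the ray (`tw_key_transfer`). -/
theorem tw_box_b (r s : ℝ) (hs1 : 19 / 20 ≤ s) (hs2 : s ≤ 1) (hr1 : 4 / 5 ≤ r)
    (hr2 : r ≤ 6 / 5) :
    12 * (7 / 8) * r ^ 12 * s ^ 14 ≤ (r + s) ^ 2 *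
      (6 * r ^ 10 + 5 * r ^ 8 * s ^ 2 + 4 * r ^ 6 * s ^ 4 + 3 * r ^ 4 * s ^ 6 + 2 * r ^ 2 *
          s ^ 8 + s ^ 10 - 6 * r ^ 10 * s ^ 6 - 4 * r ^ 8 * s ^ 8 - 2 * r ^ 6 * s ^ 10) := by
  have hr : (0 : ℝ) < r := by linarith
  have hs : (0 : ℝ) < s := by linarith
  by_cases hcase : r ≤ (6 / 5) * s
  · -- exit through the edge `s = 1` at `r' = r / s`
    have hr'1 : 4 / 5 ≤ r / s := by
      rw [le_div_iff₀ hs]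
      nlinarith
    have hr'2 : r / s ≤ 6 / 5 := by
      rw [div_le_iff₀ hs]
      linarith
    exact tw_key_transfer (r' := r / s) (s' := 1) (by norm_num) hr hs hs2
      (by field_simp) (tw_edge_b1 _ hr'1 hr'2)
  · -- exit through the edge `r = 6 / 5` at `s' = (6 / 5) * s / r`
    have hcase := not_le.mp hcase
    have hs'1 : 19 / 20 ≤ (6 / 5) * s / r := by
      rw [le_div_iff₀ hr]
      nlinarith
    have hs'2 : (6 / 5) * s / r ≤ 1 := by
      rw [div_le_iff₀ hr]
      linarith
    have hss' : s ≤ (6 / 5) * s / r := by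
      rw [le_div_iff₀ hr]
      nlinarith
    exact tw_key_transfer (r' := 6 / 5) (s' := (6 / 5) * s / r) (by norm_num) hr hs hss'
      (by field_simp) (tw_edge_b2 _ hs'1 hs'2)

/-- The cable polynomial `W(v) = 66 v⁶ - (v + 1)² (6 v⁴ + 4 v² + 2)` is nonnegative on
`[9/10, 11/10]` (Bernstein coefficients all positive; minimum `1.95` at `v = 9/10`). -/
theorem tw_W_nonneg (v : ℝ) (h1 : 9 / 10 ≤ v) (h2 : v ≤ 11 / 10) :
    0 ≤ (66 * v ^ 6 - (v + 1) ^ 2 * (6 * v ^ 4 + 4 * v ^ 2 + 2)) := by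
  have ha : (0 : ℝ) ≤ v - 9 / 10 := by linarith
  have hb : (0 : ℝ) ≤ 11 / 10 - v := by linarith
  linarith [mul_nonneg (pow_nonneg ha 0) (pow_nonneg hb 6),
    mul_nonneg (pow_nonneg ha 1) (pow_nonneg hb 5),
    mul_nonneg (pow_nonneg ha 2) (pow_nonneg hb 4),
    mul_nonneg (pow_nonneg ha 3) (pow_nonneg hb 3),
    mul_nonneg (pow_nonneg ha 4) (pow_nonneg hb 2),
    mul_nonneg (pow_nonneg ha 5) (pow_nonneg hb 1),
    mul_nonneg (pow_nonneg ha 6) (pow_nonneg hb 0)]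

/-- Clause (c) identity: along the ray `r = v s`,
`V r - V s - ω(s)(r² - s²) + (11/2) s⁻⁸ (r - s)²`
`= (v - 1)² ((v + 1)² A₁ v + s⁶ v⁶ W v) / (12 v¹² s¹²)`. -/
theorem tw_cable_eq (v s : ℝ) (hv : v ≠ 0) (hs : s ≠ 0) :
    lennardJones (v * s) - lennardJones s - (s⁻¹ ^ 7 - s⁻¹ ^ 13) / (2 * s) * ((v * s) ^ 2 - s ^ 2) +
        (11 / 2 : ℝ) * s⁻¹ ^ 8 * (v * s - s) ^ 2 =
      (v - 1) ^ 2 * ((v + 1) ^ 2 * (6 * v ^ 10 + 5 * v ^ 8 + 4 * v ^ 6 + 3 * v ^ 4 + 2 * v ^ 2 +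
          1) +
        s ^ 6 * v ^ 6 * (66 * v ^ 6 - (v + 1) ^ 2 * (6 * v ^ 4 + 4 * v ^ 2 + 2))) / (12 * v ^ 12 *
            s ^ 12) := by
  unfold lennardJones
  field_simp
  ring

/-- Clause (c): the concave cable tax `-(11/2) s⁻⁸ (r - s)² ≤ V r - V s - ω(s)(r² - s²)` for
`s ≥ 6/5`, `|r - s| ≤ s/10`. -/
theorem tw_cable (s r : ℝ) (hs : 6 / 5 ≤ s) (hrs : |r - s| ≤ s / 10) :
    -(11 / 2 : ℝ) * s⁻¹ ^ 8 * (r - s) ^ 2 ≤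
      lennardJones r - lennardJones s - (s⁻¹ ^ 7 - s⁻¹ ^ 13) / (2 * s) * (r ^ 2 - s ^ 2) := by
  have hs0 : (0 : ℝ) < s := by linarith
  obtain ⟨hl, hu⟩ := abs_le.mp hrs
  have hr0 : (0 : ℝ) < r := by linarith
  obtain ⟨v, hv, rfl⟩ : ∃ v, 0 < v ∧ r = v * s :=
    ⟨r / s, div_pos hr0 hs0, (div_mul_cancel₀ r hs0.ne').symm⟩
  have hv1 : 9 / 10 ≤ v := by nlinarith
  have hv2 : v ≤ 11 / 10 := by nlinarith
  have hW := tw_W_nonneg v hv1 hv2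
  have e := tw_cable_eq v s hv.ne' hs0.ne'
  have h0 : 0 ≤ (v - 1) ^ 2 * ((v + 1) ^ 2 * (6 * v ^ 10 + 5 * v ^ 8 + 4 * v ^ 6 + 3 * v ^ 4 + 2 *
      v ^ 2 + 1) +
        s ^ 6 * v ^ 6 * (66 * v ^ 6 - (v + 1) ^ 2 * (6 * v ^ 4 + 4 * v ^ 2 + 2))) / (12 * v ^ 12 *
            s ^ 12) := by
    apply div_nonneg
    · apply mul_nonneg (sq_nonneg _)
      apply add_nonneg
      · positivity
      · exact mul_nonneg (by positivity) hW
    · positivity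
  linarith

/-- **S1 `stub_tiltedWells`** (= `TiltedWells` of the line skeleton, verbatim): the tilted
Lennard-Jones well `Ṽ(r) = V(r) - ω(r*) r²`, `ω(r*) = (r*⁻⁷ - r*⁻¹³)/(2 r*)`, satisfies
(a) `Ṽ(r) - Ṽ(r*) ≥ (59/20)(r - r*)²` for `r* ∈ [24/25, 49/50]`, `r ∈ [9/10, 21/20]`;
(b) `Ṽ(r) - Ṽ(r*) ≥ (7/8)(r - r*)²` for `r* ∈ [19/20, 1]`, `r ∈ [4/5, 6/5]`;
(c) `Ṽ(r) - Ṽ(r*) ≥ -(11/2) r*⁻⁸ (r - r*)²` for `r* ≥ 6/5`, `|r - r*| ≤ r*/10`. -/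
theorem stub_tiltedWells :
    (∀ rs r : ℝ, 24 / 25 ≤ rs → rs ≤ 49 / 50 → 9 / 10 ≤ r → r ≤ 21 / 20 →
        (59 / 20 : ℝ) * (r - rs) ^ 2 ≤
          lennardJones r - lennardJones rs - (rs⁻¹ ^ 7 - rs⁻¹ ^ 13) / (2 * rs) * (r ^ 2 - rs ^ 2)) ∧
    (∀ rs r : ℝ, 19 / 20 ≤ rs → rs ≤ 1 → 4 / 5 ≤ r → r ≤ 6 / 5 →
        (7 / 8 : ℝ) * (r - rs) ^ 2 ≤
          lennardJones r - lennardJones rs - (rs⁻¹ ^ 7 - rs⁻¹ ^ 13) / (2 * rs) * (r ^ 2 - rs ^ 2)) ∧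
    (∀ rs r : ℝ, 6 / 5 ≤ rs → |r - rs| ≤ rs / 10 →
        -(11 / 2 : ℝ) * rs⁻¹ ^ 8 * (r - rs) ^ 2 ≤
          lennardJones r - lennardJones rs - (rs⁻¹ ^ 7 - rs⁻¹ ^ 13) / (2 * rs) * (r ^ 2 -
              rs ^ 2)) := by
  refine ⟨?_, ?_, ?_⟩
  · intro s r hs1 hs2 hr1 hr2
    exact tw_of_key (by linarith) (by linarith) (tw_box_a r s hs1 hs2 hr1 hr2)
  · intro s r hs1 hs2 hr1 hr2
    exact tw_of_key (by linarith) (by linarith) (tw_box_b r s hs1 hs2 hr1 hr2)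
  · intro s r hs hrs
    exact tw_cable s r hs hrs

end Summit.AtomisticToContinuum.Crystallization.Theorems.PrestressSplitKorn
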